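import Summits.AtomisticToContinuum.BoseEinsteinCondensation.Theorems.GroundStateRigidity.Negative.BoxReflection
import Summits.AtomisticToContinuum.BoseEinsteinCondensation.Theorems.GroundStateRigidity.Negative.LoadBearingHypotheses
import HarnessLib

/-!
# Two unit hard spheres in a small box: support of finite-energy states and the class cut-off

`GroundStateRigidity` (crux stmt-AtomisticToContinuum-9072, shared by 8 routes of `BoseEinsteinCondensation`):
negative-side support, second of the four files
`Negative/BoxReflection.lean` → `Negative/TwoHardSpheresSupport.lean` → `Negative/TwoHardSpheresLocalisation.lean`
→ `Negative/TwoHardSpheres.lean` (kernel-checked by the crux disprover `refuter-cdisprove-stmt-AtomisticToContinuum-9072-0`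
as §4 of `Cruxes/GroundStateRigidity/Disproof.lean`, 2026-08-16; landed verbatim up to docstrings by the line lead c1).
Together they prove that two unit hard spheres (`v = ⊤·1_{[0,1]}`, an ADMISSIBLE interaction) in a box `Λ_L` with
`1/3 < L² < 1/2` have finite ground-state energy but NO rigid (phase-unique) ground state.  None of this refutes the
crux (which lives at `L = (N/ρ)^{1/3} ≫ 1`, `ρ < ρ₀`); it shows that uniqueness for unbounded admissible `v` is
genuinely density-dependent and cannot be a soft Perron–Frobenius argument.

This file: the unit hard-sphere profile `hardSphere`; the class function `q(X) = (x₁ - x₂)₀ · (x₁ - x₂)₁`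
(Bose-symmetric, odd under the reflection `reflC` of `BoxReflection.lean`); the geometric fact that in a box with
`2L² < 1` two centres at distance `≥ 1` have `|q| > 1 - 2L²`; finite energy forces a `C¹` two-body state to vanish
on the open collision region `{|x₁ - x₂| < 1}`, hence to live on `{|q| > 1 - 2L²}` with vanishing derivative on
`{|q| < 1 - 2L²}`; and the smooth class cut-off `cut g = step g ∘ q` with weight `wt = |cut|²`, flat wherever a
finite-energy state lives (`∇(cut·Ψ) = cut·∇Ψ`).
-/

noncomputable section

namespace Summit.AtomisticToContinuum.BoseEinsteinCondensation.Theorems.GroundStateRigidity.Negative.TwoHardSpheres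

open Literature.MathematicalPhysics.QuantumManyBody.BoseGas
open MeasureTheory Filter Metric
open scoped ENNReal NNReal Topology

variable {N : ℕ}

/-! ### The unit hard-sphere interaction -/

/-- Unit hard spheres: `v = ⊤ · 1_{[0, 1]}` (admissible: measurable, range `1`). -/
def hardSphere : ℝ → ℝ≥0∞ := fun r => if r ≤ 1 then ⊤ else 0

/-- `hardSphere` is an admissible (repulsive, finite-range) interaction
(`Negative.isRepulsiveFiniteRange_hardSphere`, restated for the named profile). -/
theorem isRepulsiveFiniteRange_hardSphere : IsRepulsiveFiniteRange hardSphere :=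
  Negative.isRepulsiveFiniteRange_hardSphere

/-! ### Two unit hard spheres in a small box: geometry -/

/-- Inside the core (`r ≤ 1`) the hard-sphere profile is `⊤`. -/
theorem hardSphere_of_le_one {r : ℝ} (hr : r ≤ 1) : hardSphere r = ⊤ := by simp [hardSphere, hr]

/-- The class function `q(X) = (x₁ - x₂)₀ · (x₁ - x₂)₁` (product of the first two components of the
relative coordinate): Bose symmetric, odd under the reflection `reflC`. -/
def qfun (X : Config 2) : ℝ := (X 0 0 - X 1 0) * (X 0 1 - X 1 1)

/-- `q` is continuous. -/
theorem continuous_qfun : Continuous qfun := by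
  unfold qfun
  fun_prop

/-- `q` is odd under the reflection `x₀ ↦ L - x₀`. -/
theorem qfun_reflC (L : ℝ) (X : Config 2) : qfun (reflC L X) = -qfun X := by
  simp [qfun, reflC_apply]
  ring

/-- `Fin 2 = {0, 1}`. -/
theorem fin_two_eq (i : Fin 2) : i = 0 ∨ i = 1 := by
  rcases i with ⟨i, hi⟩
  interval_cases i
  · exact Or.inl rfl
  · exact Or.inr rfl

/-- `q` is Bose symmetric (invariant under relabelling the two particles). -/
theorem qfun_comp_perm (σ : Equiv.Perm (Fin 2)) (X : Config 2) : qfun (X ∘ σ) = qfun X := by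
  rcases fin_two_eq (σ 0) with h0 | h0
  · have h1 : σ 1 = 1 := by
      rcases fin_two_eq (σ 1) with h1 | h1
      · exact absurd (σ.injective (h1.trans h0.symm)) (by decide)
      · exact h1
    simp [qfun, h0, h1]
  · have h1 : σ 1 = 0 := by
      rcases fin_two_eq (σ 1) with h1 | h1
      · exact h1
      · exact absurd (σ.injective (h1.trans h0.symm)) (by decide)
    simp [qfun, h0, h1]
    ring

/-- In a box with `2L² < 1`, two centres at distance `≥ 1` have `|q| > 1 - 2L²`: every component
of the relative coordinate exceeds `√(1 - 2L²)` in absolute value. -/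
theorem lt_abs_qfun {L : ℝ} {X : Config 2} (hX : X ∈ boxN 2 L)
    (hd : 1 ≤ dist (X 0) (X 1)) : 1 - 2 * L ^ 2 < |qfun X| := by
  have hc : ∀ (i : Fin 2) (k : Fin 3), 0 < X i k ∧ X i k < L := fun i k => hX i k
  have hsq : 1 ≤ ∑ k, (X 0 k - X 1 k) ^ 2 := by
    have h1 : (1 : ℝ) ≤ dist (X 0) (X 1) ^ 2 := by nlinarith
    rw [EuclideanSpace.dist_eq, Real.sq_sqrt (Finset.sum_nonneg fun k _ => sq_nonneg _)] at h1
    simpa [Real.dist_eq, sq_abs] using h1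
  simp only [Fin.sum_univ_three] at hsq
  have b0 := hc 0 0; have b1 := hc 0 1; have b2 := hc 0 2
  have c0 := hc 1 0; have c1 := hc 1 1; have c2 := hc 1 2
  have hd2 : (X 0 2 - X 1 2) ^ 2 < L ^ 2 := by nlinarith
  have hd1 : (X 0 1 - X 1 1) ^ 2 < L ^ 2 := by nlinarith
  have hd0 : (X 0 0 - X 1 0) ^ 2 < L ^ 2 := by nlinarith
  have e0 : 1 - 2 * L ^ 2 < (X 0 0 - X 1 0) ^ 2 := by linarith
  have e1 : 1 - 2 * L ^ 2 < (X 0 1 - X 1 1) ^ 2 := by linarith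
  -- `|q|² = d₀² d₁² > (1 - 2L²)²` when `1 - 2L² ≥ 0`; if `1 - 2L² < 0` the claim is trivial
  by_cases hg : 0 ≤ 1 - 2 * L ^ 2
  · have hq2 : (1 - 2 * L ^ 2) ^ 2 < qfun X ^ 2 := by
      have : qfun X ^ 2 = (X 0 0 - X 1 0) ^ 2 * (X 0 1 - X 1 1) ^ 2 := by simp [qfun]; ring
      rw [this]
      calc (1 - 2 * L ^ 2) ^ 2 = (1 - 2 * L ^ 2) * (1 - 2 * L ^ 2) := by ring
        _ < (X 0 0 - X 1 0) ^ 2 * (X 0 1 - X 1 1) ^ 2 := by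
            apply mul_lt_mul'' e0 e1 hg hg
    have := sq_lt_sq.1 hq2
    rwa [abs_of_nonneg hg] at this
  · push Not at hg
    exact hg.trans_le (abs_nonneg _)


/-! ### Finite energy forces vanishing on the collision region -/

/-- A continuous function that does not vanish at a point of an open set has positive `L²` mass on it. -/
theorem setLIntegral_pos_of_continuous {f : Config N → ℂ} (hf : Continuous f) {S : Set (Config N)}
    (hS : IsOpen S) {X : Config N} (hX : X ∈ S) (hfX : f X ≠ 0) :
    0 < ∫⁻ Y in S, (‖f Y‖₊ : ℝ≥0∞) ^ 2 := by
  have hpos : 0 < ‖f X‖ := norm_pos_iff.2 hfX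
  set T : Set (Config N) := S ∩ {Y | ‖f X‖ / 2 < ‖f Y‖} with hT
  have hTo : IsOpen T := hS.inter (isOpen_lt continuous_const hf.norm)
  have hXT : X ∈ T := ⟨hX, by show ‖f X‖ / 2 < ‖f X‖; linarith⟩
  obtain ⟨r, hr, hball⟩ := Metric.isOpen_iff.1 hTo X hXT
  have hc : ∀ Y ∈ ball X r, ENNReal.ofReal (‖f X‖ / 2) ^ 2 ≤ (‖f Y‖₊ : ℝ≥0∞) ^ 2 := by
    intro Y hY
    have h := (hball hY).2
    have : ENNReal.ofReal (‖f X‖ / 2) ≤ (‖f Y‖₊ : ℝ≥0∞) := by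
      rw [← enorm_eq_nnnorm, ← ofReal_norm]
      exact ENNReal.ofReal_le_ofReal h.le
    gcongr
  calc (0 : ℝ≥0∞) < ENNReal.ofReal (‖f X‖ / 2) ^ 2 * volume (ball X r) := by
        refine ENNReal.mul_pos ?_ (measure_ball_pos volume X hr).ne'
        exact (ENNReal.pow_pos (ENNReal.ofReal_pos.2 (by linarith)) 2).ne'
    _ = ∫⁻ _ in ball X r, ENNReal.ofReal (‖f X‖ / 2) ^ 2 := (setLIntegral_const _ _).symm
    _ ≤ ∫⁻ Y in ball X r, (‖f Y‖₊ : ℝ≥0∞) ^ 2 := setLIntegral_mono' measurableSet_ball hc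
    _ ≤ ∫⁻ Y in S, (‖f Y‖₊ : ℝ≥0∞) ^ 2 :=
        lintegral_mono_set (fun Y hY => (hball hY).1)

/-- For two unit hard spheres the interaction is `⊤` whenever the centres are within distance `1`. -/
theorem interaction_two_eq_top {X : Config 2} (hX : dist (X 0) (X 1) ≤ 1) :
    interaction hardSphere X = ⊤ := by
  unfold interaction
  rw [ENNReal.sum_eq_top]
  refine ⟨0, Finset.mem_univ _, ?_⟩
  rw [ENNReal.sum_eq_top]
  exact ⟨1, by simp, hardSphere_of_le_one hX⟩

/-- **Finite energy ⇒ the wave function vanishes on the open collision region** `{|x₁ - x₂| < 1}`. -/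
theorem eq_zero_of_dist_lt_one {L : ℝ} (Ψ : TrialState 2 L) (hE : energy hardSphere Ψ ≠ ⊤)
    {X : Config 2} (hX : dist (X 0) (X 1) < 1) : Ψ.ψ X = 0 := by
  by_contra h
  set S : Set (Config 2) := {Y | dist (Y 0) (Y 1) < 1} with hSdef
  have hS : IsOpen S := isOpen_lt (by fun_prop) continuous_const
  have hpos := setLIntegral_pos_of_continuous Ψ.contDiff.continuous hS (show X ∈ S from hX) h
  have hm : Measurable fun Y => (‖Ψ.ψ Y‖₊ : ℝ≥0∞) ^ 2 :=
    (Ψ.contDiff.continuous.measurable.nnnorm.coe_nnreal_ennreal).pow_const 2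
  apply hE
  apply eq_top_iff.2
  calc (⊤ : ℝ≥0∞) = ⊤ * ∫⁻ Y in S, (‖Ψ.ψ Y‖₊ : ℝ≥0∞) ^ 2 := (ENNReal.top_mul hpos.ne').symm
    _ = ∫⁻ Y in S, ⊤ * (‖Ψ.ψ Y‖₊ : ℝ≥0∞) ^ 2 := (lintegral_const_mul _ hm).symm
    _ = ∫⁻ Y in S, interaction hardSphere Y * (‖Ψ.ψ Y‖₊ : ℝ≥0∞) ^ 2 := by
        refine setLIntegral_congr_fun hS.measurableSet (fun Y hY => ?_)
        rw [interaction_two_eq_top (le_of_lt hY)]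
    _ ≤ ∫⁻ Y, interaction hardSphere Y * (‖Ψ.ψ Y‖₊ : ℝ≥0∞) ^ 2 := setLIntegral_le_lintegral _ _
    _ ≤ energy hardSphere Ψ := lintegral_mono fun Y => le_add_self

/-- **Support dichotomy** (`2L² < 1`): wherever a finite-energy two-body state is nonzero,
`|q| > 1 - 2L²`. -/
theorem lt_abs_qfun_of_ne_zero {L : ℝ} (Ψ : TrialState 2 L) (hE : energy hardSphere Ψ ≠ ⊤)
    {X : Config 2} (hX : Ψ.ψ X ≠ 0) : 1 - 2 * L ^ 2 < |qfun X| := by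
  have hXb : X ∈ boxN 2 L := by
    by_contra hc
    exact hX (Ψ.eq_zero X hc)
  have hd : 1 ≤ dist (X 0) (X 1) := by
    by_contra hc
    push Not at hc
    exact hX (eq_zero_of_dist_lt_one Ψ hE hc)
  exact lt_abs_qfun hXb hd

/-- On the open set `{|q| < 1 - 2L²}` a finite-energy state vanishes identically near every point. -/
theorem eventuallyEq_zero {L : ℝ} (Ψ : TrialState 2 L) (hE : energy hardSphere Ψ ≠ ⊤)
    {X : Config 2} (hq : |qfun X| < 1 - 2 * L ^ 2) : Ψ.ψ =ᶠ[𝓝 X] fun _ => 0 := by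
  have hO : IsOpen {Y : Config 2 | |qfun Y| < 1 - 2 * L ^ 2} :=
    isOpen_lt (continuous_qfun.abs) continuous_const
  refine Filter.eventuallyEq_of_mem (hO.mem_nhds hq) fun Y hY => ?_
  by_contra h
  exact absurd (lt_abs_qfun_of_ne_zero Ψ hE h) (not_lt.2 (le_of_lt hY))

/-- On `{|q| < 1 - 2L²}` the derivative of a finite-energy state vanishes. -/
theorem fderiv_eq_zero_of_abs_qfun_lt {L : ℝ} (Ψ : TrialState 2 L) (hE : energy hardSphere Ψ ≠ ⊤)
    {X : Config 2} (hq : |qfun X| < 1 - 2 * L ^ 2) : fderiv ℝ Ψ.ψ X = 0 := by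
  rw [(eventuallyEq_zero Ψ hE hq).fderiv_eq]
  exact fderiv_const_apply _

/-- On `{|q| < 1 - 2L²}` the kinetic density of a finite-energy state vanishes. -/
theorem kineticDensity_eq_zero_of_abs_qfun_lt {L : ℝ} (Ψ : TrialState 2 L)
    (hE : energy hardSphere Ψ ≠ ⊤) {X : Config 2} (hq : |qfun X| < 1 - 2 * L ^ 2) :
    kineticDensity Ψ.ψ X = 0 := by
  simp [kineticDensity, fderiv_eq_zero_of_abs_qfun_lt Ψ hE hq]

/-! ### The smooth class cut-off -/

/-- Smooth step: `0` on `(-∞, -g]`, `1` on `[g, ∞)`. -/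
def step (g t : ℝ) : ℝ := Real.smoothTransition ((t + g) / (2 * g))

/-- `step g = 1` on `[g, ∞)`. -/
theorem step_of_le {g t : ℝ} (hg : 0 < g) (ht : g ≤ t) : step g t = 1 :=
  Real.smoothTransition.one_of_one_le (by rw [le_div_iff₀ (by linarith)]; linarith)

/-- `step g = 0` on `(-∞, -g]`. -/
theorem step_of_le_neg {g t : ℝ} (hg : 0 < g) (ht : t ≤ -g) : step g t = 0 :=
  Real.smoothTransition.zero_of_nonpos (div_nonpos_of_nonpos_of_nonneg (by linarith) (by linarith))

/-- `0 ≤ step`. -/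
theorem step_nonneg (g t : ℝ) : 0 ≤ step g t := Real.smoothTransition.nonneg _

/-- `step ≤ 1`. -/
theorem step_le_one (g t : ℝ) : step g t ≤ 1 := Real.smoothTransition.le_one _

/-- `step g` is `C¹`. -/
theorem contDiff_step (g : ℝ) : ContDiff ℝ 1 (step g) := by
  unfold step
  exact Real.smoothTransition.contDiff.comp ((contDiff_id.add contDiff_const).div_const _)

/-- Beyond the threshold the two cut-offs `step g t`, `step g (-t)` are `{1, 0}` or `{0, 1}`. -/
theorem step_dichotomy {g t : ℝ} (hg : 0 < g) (ht : g ≤ |t|) :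
    (step g t = 1 ∧ step g (-t) = 0) ∨ (step g t = 0 ∧ step g (-t) = 1) := by
  rcases le_abs'.1 ht with h | h
  · exact Or.inr ⟨step_of_le_neg hg h, step_of_le hg (by linarith)⟩
  · exact Or.inl ⟨step_of_le hg h, step_of_le_neg hg (by linarith)⟩

/-! ### Localisation of a finite-energy two-body state to the class `{q > 0}` -/

/-- `q` is `C¹` (a polynomial in the coordinates). -/
theorem contDiff_qfun : ContDiff ℝ 1 qfun := by
  unfold qfun
  fun_prop

/-- The complex cut-off multiplier `X ↦ step g (q X)`. -/
def cut (g : ℝ) (X : Config 2) : ℂ := ((step g (qfun X) : ℝ) : ℂ)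

/-- The cut-off is `C¹`. -/
theorem contDiff_cut (g : ℝ) : ContDiff ℝ 1 (cut g) :=
  Complex.ofRealCLM.contDiff.comp ((contDiff_step g).comp contDiff_qfun)

/-- `‖cut g X‖ = step g (q X)` (the cut-off is real and nonnegative). -/
theorem coe_nnnorm_cut (g : ℝ) (X : Config 2) :
    (‖cut g X‖₊ : ℝ≥0∞) = ENNReal.ofReal (step g (qfun X)) := by
  rw [cut, Complex.nnnorm_real, ← enorm_eq_nnnorm, Real.enorm_eq_ofReal (step_nonneg _ _)]

/-- The `[0,1]`-weight `W = |cut|²`. -/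
def wt (g : ℝ) (X : Config 2) : ℝ≥0∞ := (‖cut g X‖₊ : ℝ≥0∞) ^ 2

/-- The weight in terms of `step`. -/
theorem wt_eq (g : ℝ) (X : Config 2) : wt g X = ENNReal.ofReal (step g (qfun X)) ^ 2 := by
  rw [wt, coe_nnnorm_cut]

/-- Beyond the threshold the weights of a point and of its reflection add up to `1`. -/
theorem wt_add_wt_reflC {g L : ℝ} (hg : 0 < g) {X : Config 2} (hq : g ≤ |qfun X|) :
    wt g X + wt g (reflC L X) = 1 := by
  simp only [wt_eq, qfun_reflC]
  rcases step_dichotomy hg hq with ⟨h1, h2⟩ | ⟨h1, h2⟩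
  · simp [h1, h2]
  · simp [h1, h2]

/-- The weight is at most `1`. -/
theorem wt_le_one (g : ℝ) (X : Config 2) : wt g X ≤ 1 := by
  rw [wt_eq]
  calc ENNReal.ofReal (step g (qfun X)) ^ 2 ≤ (1 : ℝ≥0∞) ^ 2 := by
        gcongr
        rw [← ENNReal.ofReal_one]
        exact ENNReal.ofReal_le_ofReal (step_le_one _ _)
    _ = 1 := one_pow 2

/-- near points where `cut` is locally constant its derivative vanishes -/
theorem fderiv_cut_eq_zero {g : ℝ} (hg : 0 < g) {X : Config 2} (hq : g < |qfun X|) :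
    fderiv ℝ (cut g) X = 0 := by
  rcases lt_abs.1 hq with h | h
  · -- `q > g` near `X`: `cut = 1`
    have hO : IsOpen {Y : Config 2 | g < qfun Y} := isOpen_lt continuous_const continuous_qfun
    have hev : cut g =ᶠ[𝓝 X] fun _ => (1 : ℂ) :=
      Filter.eventuallyEq_of_mem (hO.mem_nhds h) fun Y hY => by
        simp [cut, step_of_le hg (le_of_lt hY)]
    rw [hev.fderiv_eq]
    exact fderiv_const_apply _
  · have hO : IsOpen {Y : Config 2 | qfun Y < -g} := isOpen_lt continuous_qfun continuous_const
    have h' : qfun X < -g := by linarith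
    have hev : cut g =ᶠ[𝓝 X] fun _ => (0 : ℂ) :=
      Filter.eventuallyEq_of_mem (hO.mem_nhds h') fun Y hY => by
        simp [cut, step_of_le_neg hg (le_of_lt hY)]
    rw [hev.fderiv_eq]
    exact fderiv_const_apply _

/-- **Derivative of the localised function**: the cut-off is flat wherever the state lives, so
`∇(cut · Ψ) = cut · ∇Ψ` everywhere. -/
theorem fderiv_cut_mul {L : ℝ} (hL : 2 * L ^ 2 < 1) (Ψ : TrialState 2 L)
    (hE : energy hardSphere Ψ ≠ ⊤) (X : Config 2) :
    fderiv ℝ (fun Y => cut (1 - 2 * L ^ 2) Y * Ψ.ψ Y) X =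
      cut (1 - 2 * L ^ 2) X • fderiv ℝ Ψ.ψ X := by
  have hg : 0 < 1 - 2 * L ^ 2 := by linarith
  have hc : DifferentiableAt ℝ (cut (1 - 2 * L ^ 2)) X :=
    ((contDiff_cut _).differentiable one_ne_zero) X
  have hd : DifferentiableAt ℝ Ψ.ψ X := (Ψ.contDiff.differentiable one_ne_zero) X
  change fderiv ℝ (cut (1 - 2 * L ^ 2) * Ψ.ψ) X = _
  rw [fderiv_mul hc hd]
  by_cases hX : Ψ.ψ X = 0
  · rw [hX]
    ext1 w
    simp
  · rw [fderiv_cut_eq_zero hg (lt_abs_qfun_of_ne_zero Ψ hE hX)]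
    ext1 w
    simp

/-- Kinetic density of the localised function: `|∇(cut·Ψ)|² = wt · |∇Ψ|²`. -/
theorem kineticDensity_cut_mul {L : ℝ} (hL : 2 * L ^ 2 < 1) (Ψ : TrialState 2 L)
    (hE : energy hardSphere Ψ ≠ ⊤) (X : Config 2) :
    kineticDensity (fun Y => cut (1 - 2 * L ^ 2) Y * Ψ.ψ Y) X =
      wt (1 - 2 * L ^ 2) X * kineticDensity Ψ.ψ X := by
  simp only [kineticDensity, fderiv_cut_mul hL Ψ hE X, FunLike.coe_smul, Pi.smul_apply,
    nnnorm_smul, ENNReal.coe_mul, mul_pow, wt, Finset.mul_sum]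

/-- Density of the localised function: `|cut·Ψ|² = wt · |Ψ|²`. -/
theorem nnnorm_cut_mul_sq (g : ℝ) (Ψ : Config 2 → ℂ) (X : Config 2) :
    (‖cut g X * Ψ X‖₊ : ℝ≥0∞) ^ 2 = wt g X * (‖Ψ X‖₊ : ℝ≥0∞) ^ 2 := by
  rw [nnnorm_mul, ENNReal.coe_mul, mul_pow, wt]


end Summit.AtomisticToContinuum.BoseEinsteinCondensation.Theorems.GroundStateRigidity.Negative.TwoHardSpheres

end
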